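import Summits.RiemannHypothesis.RiemannHypothesis.Theorems.WeilBochnerMeasureCounting
import HarnessLib

/-!
# RiemannHypothesis — the counting law of a Bochner–Kreĭn measure on intervals `(T₁, T₂]`

Helper file (`--supports stmt-RiemannHypothesis-0098`), RH-free, standard axioms.  Seat rh-explicit
weil-3 (structure).  Backlund's formula for differences: for every measure `μ` representing Weil's form
on a window `[-b, b]` (`b > 0`) there is `C` with

* `abs_measureReal_Ioc_sub_theta_le`: `|μ(T₁, T₂] − (θ(T₂) − θ(T₁))/π| ≤ C (1 + log(1 + T₂))` for
  `0 ≤ T₁ ≤ T₂`;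
* `abs_measureReal_Ico_neg_sub_theta_le`: `|μ[-T₂, -T₁) − (θ(T₂) − θ(T₁))/π| ≤ C (1 + log(1 + T₂))`.

(Subtract the counting laws `abs_measureReal_Icc_sub_theta_le` at `T₁` and `T₂`.)  This is the form in
which the data tracks count spectral mass in a height window.
-/

noncomputable section

set_option linter.dupNamespace false  -- the mandated namespace repeats `RiemannHypothesis`

open Complex Filter Set MeasureTheory
open scoped Real Topology
open Literature.NumberTheory.LFunctions

namespace Summit.RiemannHypothesis.RiemannHypothesis.Theorems.WeilBochnerMeasure

variable {b : ℝ} {μ : Measure ℝ}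

/-- **Counting law on `(T₁, T₂]`.**  For `0 ≤ T₁ ≤ T₂`:
`|μ(T₁, T₂] − (θ(T₂) − θ(T₁))/π| ≤ C (1 + log(1 + T₂))`. -/
theorem abs_measureReal_Ioc_sub_theta_le (hb : 0 < b)
    (hμ : ∀ g : ℝ → ℂ, IsWeilTest g → tsupport g ⊆ Icc (-b) b →
      Integrable (fun t : ℝ ↦ ‖weilMellin g (1 / 2 + t * I)‖ ^ 2) μ ∧
        weilQuadratic g = ((∫ t, ‖weilMellin g (1 / 2 + t * I)‖ ^ 2 ∂μ : ℝ) : ℂ)) :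
    ∃ C : ℝ, ∀ T₁ T₂ : ℝ, 0 ≤ T₁ → T₁ ≤ T₂ →
      |μ.real (Ioc T₁ T₂) - (riemannSiegelTheta T₂ - riemannSiegelTheta T₁) / π| ≤
        C * (1 + Real.log (1 + T₂)) := by
  obtain ⟨C, hC⟩ := abs_measureReal_Icc_sub_theta_le hb hμ
  have hC0 : 0 ≤ C := by
    have h00 := (hC 0 le_rfl).1
    simp only [riemannSiegelTheta_zero, zero_div, sub_zero, add_zero, Real.log_one, mul_one] at h00
    exact (abs_nonneg _).trans h00
  refine ⟨2 * C, fun T₁ T₂ hT₁ hT₁₂ ↦ ?_⟩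
  have h1 := (hC T₁ hT₁).1
  have h2 := (hC T₂ (hT₁.trans hT₁₂)).1
  have hfin : μ (Icc 0 T₁) ≠ ⊤ := (measure_Icc_lt_top hb hμ _ _).ne
  have hfin' : μ (Ioc T₁ T₂) ≠ ⊤ :=
    (lt_of_le_of_lt (measure_mono Ioc_subset_Icc_self) (measure_Icc_lt_top hb hμ _ _)).ne
  have hsplit : μ.real (Icc 0 T₂) = μ.real (Icc 0 T₁) + μ.real (Ioc T₁ T₂) := by
    rw [← Icc_union_Ioc_eq_Icc hT₁ hT₁₂]
    exact measureReal_union (Set.disjoint_left.2 fun t ht ht' ↦ by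
      simp only [mem_Icc, mem_Ioc] at ht ht'; linarith [ht.2, ht'.1]) measurableSet_Ioc hfin hfin'
  have hlog : Real.log (1 + T₁) ≤ Real.log (1 + T₂) := Real.log_le_log (by linarith) (by linarith)
  have hlog0 : 0 ≤ Real.log (1 + T₁) := Real.log_nonneg (by linarith)
  have hCl : C * Real.log (1 + T₁) ≤ C * Real.log (1 + T₂) := mul_le_mul_of_nonneg_left hlog hC0
  rw [sub_div]
  rw [abs_le] at h1 h2 ⊢
  constructor <;> linarith [h1.1, h1.2, h2.1, h2.2]

/-- **Counting law on `[-T₂, -T₁)`.**  For `0 ≤ T₁ ≤ T₂`: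
`|μ[-T₂, -T₁) − (θ(T₂) − θ(T₁))/π| ≤ C (1 + log(1 + T₂))`. -/
theorem abs_measureReal_Ico_neg_sub_theta_le (hb : 0 < b)
    (hμ : ∀ g : ℝ → ℂ, IsWeilTest g → tsupport g ⊆ Icc (-b) b →
      Integrable (fun t : ℝ ↦ ‖weilMellin g (1 / 2 + t * I)‖ ^ 2) μ ∧
        weilQuadratic g = ((∫ t, ‖weilMellin g (1 / 2 + t * I)‖ ^ 2 ∂μ : ℝ) : ℂ)) :
    ∃ C : ℝ, ∀ T₁ T₂ : ℝ, 0 ≤ T₁ → T₁ ≤ T₂ →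
      |μ.real (Ico (-T₂) (-T₁)) - (riemannSiegelTheta T₂ - riemannSiegelTheta T₁) / π| ≤
        C * (1 + Real.log (1 + T₂)) := by
  obtain ⟨C, hC⟩ := abs_measureReal_Icc_sub_theta_le hb hμ
  have hC0 : 0 ≤ C := by
    have h00 := (hC 0 le_rfl).1
    simp only [riemannSiegelTheta_zero, zero_div, sub_zero, add_zero, Real.log_one, mul_one] at h00
    exact (abs_nonneg _).trans h00
  refine ⟨2 * C, fun T₁ T₂ hT₁ hT₁₂ ↦ ?_⟩
  have h1 := (hC T₁ hT₁).2
  have h2 := (hC T₂ (hT₁.trans hT₁₂)).2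
  have hfin : μ (Icc (-T₁) 0) ≠ ⊤ := (measure_Icc_lt_top hb hμ _ _).ne
  have hfin' : μ (Ico (-T₂) (-T₁)) ≠ ⊤ :=
    (lt_of_le_of_lt (measure_mono Ico_subset_Icc_self) (measure_Icc_lt_top hb hμ _ _)).ne
  have hsplit : μ.real (Icc (-T₂) 0) = μ.real (Ico (-T₂) (-T₁)) + μ.real (Icc (-T₁) 0) := by
    rw [← Ico_union_Icc_eq_Icc (by linarith : -T₂ ≤ -T₁) (by linarith : -T₁ ≤ 0)]
    exact measureReal_union (Set.disjoint_left.2 fun t ht ht' ↦ by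
      simp only [mem_Icc, mem_Ico] at ht ht'; linarith [ht.2, ht'.1]) measurableSet_Icc hfin' hfin
  have hlog : Real.log (1 + T₁) ≤ Real.log (1 + T₂) := Real.log_le_log (by linarith) (by linarith)
  have hlog0 : 0 ≤ Real.log (1 + T₁) := Real.log_nonneg (by linarith)
  have hCl : C * Real.log (1 + T₁) ≤ C * Real.log (1 + T₂) := mul_le_mul_of_nonneg_left hlog hC0
  rw [sub_div]
  rw [abs_le] at h1 h2 ⊢
  constructor <;> linarith [h1.1, h1.2, h2.1, h2.2]

end Summit.RiemannHypothesis.RiemannHypothesis.Theorems.WeilBochnerMeasure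

end
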